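import Literature.NumberTheory.EllipticCurves.BigGaloisRepSelmer
import Literature.NumberTheory.EllipticCurves.H1UnramifiedFiniteProofs
import Literature.NumberTheory.EllipticCurves.ZpExtensionUnramifiedProofs
import Literature.NumberTheory.GaloisRepresentations.DecompositionGroupOfCompletion
import Literature.NumberTheory.GaloisRepresentations.IntegralGaloisActionProofs
import HarnessLib

/-!
# Cocycle tools for Greenberg–Selmer groups: lifting torsion classes to torsion cocycles,
# vanishing on trivially acting subgroups, torsion of cocycles of a compact group, and
# finiteness of the cocycles unramified outside `S` with finite coefficients (localMap convention)

`Proofs` file (theorems only: no definition, no named fact, no instance; D-0026), cell `bsd-stepL`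
(typer lane), written for the discharge of `SkinnerUrban2014.lemma319_finite_XBig`
([SU14] Lemma 3.1.9 after Greenberg: `X^Σ = Sel^Σ_𝔮(K, T ⊗ Λ^*)^∨` is a finitely generated
`Λ`-module; plan `pub/bsd-cited/sheets/NOTE-r17-FG-lemma319-discharge-plan.md`, module F2).
Everything here is elementary degree-one cocycle bookkeeping on Mathlib's continuous cohomology
through the explicit crossed homomorphisms of `GaloisRepresentations/ContinuousH1`:

* §1 (any topological representation `X` of `G` whose orbit maps `g ↦ g·v` are continuous):
  coboundaries `g ↦ g·v − v` are continuous cocycles (`exists_contOneCocycles_apply_eq_sub`); the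
  LIFT: if `r ∈ R` acts surjectively on `X` and `r·c = 0` in `H¹(G, X)`, then `c = [z]` for a
  cocycle `z` with `r·z = 0` POINTWISE (`exists_oneCocycleClass_eq_forall_smul_apply_eq_zero`:
  `r·z₀ = ∂m`, `m = r·m'`, `z := z₀ − ∂m'`). [Serre, *Galois Cohomology*, I §2.2, I §5.1.]
* §2 (`G` compact, `X` discrete): a continuous cocycle has finite range, so if every element of
  `X` is killed by a power of `r` then every cocycle, and every class of `H¹(G, X)`, is killed by
  a power of `r` (`exists_pow_smul_apply_eq_zero`, `exists_pow_smul_eq_zero_and` for two scalars).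
  [Serre, *Galois Cohomology*, I §2.2 (cochains with values in a discrete module).]
* §3 (the tree's `ContinuousRep` / `BigGaloisRep.resH1` convention): the restriction of `[z]`
  along `θ : H → Γ` vanishes iff `z ∘ θ` is a coboundary `h ↦ θ(h)·a − a`
  (`resH1_oneCocycleClass_eq_zero_iff`); hence when `θ(H)` acts trivially on the module,
  `res_θ [z] = 0` iff `z ∘ θ = 0` as a function (`apply_eq_zero_of_resH1_eq_zero`,
  `resH1_oneCocycleClass_eq_zero_of_forall_apply_eq_zero`). [Serre, I §2.4, I §5.1.]
* §4 (number fields; Silverman X.4.3 in the `localMap` convention of `BigGaloisRepSelmer`): for a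
  continuous representation `ρ` of `Γ_K` on a discrete `A`-module `M`, a scalar `r` with
  `M[r] = {m | r·m = 0}` FINITE and a finite set `S` of finite places, the set of continuous
  cocycles `z : Γ_K → M` with `r·z = 0` that VANISH on the inertia group `localMap K (Sum.inr w)`
  of every `w ∉ S` is finite (`finite_setOf_contOneCocycles_smul_eq_zero_vanishing_inertia`):
  such a `z` is an `M[r]`-valued cocycle of the discrete `Γ_K`-module `M[r]` whose class is
  unramified outside `S` in the sense of `h1Unramified` (at the chosen prime `𝔓₀` of `\bar ℤ_K`
  above `w` because `I_{𝔓₀} = range (localMap K (Sum.inr w))`,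
  `inertia_adicCompletionPrime_eq_map_absInertia`; at a conjugate prime `g·𝔓₀` because
  `z(gσg⁻¹) = τ·a − a` with `τ = gσg⁻¹`, `a = −z(g)` when `z(σ) = 0`, and every prime above `w` is
  a conjugate, `exists_smul_eq_of_mem_primesAbove_holds`), and those cocycles form a finite set by
  the tree's PROVED Lemma X.4.3 (`finite_setOf_oneCocycleClass_mem_h1Unramified` fed with
  `finite_unramifiedHoms_holds`). [Silverman AEC X.4.3; Neukirch ANT I (9.4).]

References: [SerreGaloisCohomology1997] I §2.2, §2.4, §5.1; [SilvermanAEC2009] Lemma X.4.3 (and its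
proof); [NeukirchANT1999] Ch. I §9 (9.4); [SkinnerUrban2014] Lemma 3.1.9; [GreenbergLNM1716] §4.
-/

noncomputable section

open CategoryTheory Field IsDedekindDomain NumberField
open Literature.NumberTheory.GaloisRepresentations

universe u v

namespace Literature.NumberTheory.EllipticCurves.BigGaloisRep

/-! ### §1. Coboundaries and the lift of an `r`-torsion class to an `r`-torsion cocycle -/

section Lift

open TopRep ContRepresentation ContinuousCohomology

variable {R : Type u} [Ring R] [TopologicalSpace R]
variable {G : Type v} [Group G] [TopologicalSpace G] [IsTopologicalGroup G]
variable (X : TopRep.{v} R G)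

omit [IsTopologicalGroup G] in
/-- **Coboundaries are continuous cocycles**: for `v ∈ X` with continuous orbit map `g ↦ g·v`, the
principal crossed homomorphism `g ↦ g·v − v` is a continuous 1-cocycle.
[cite: SerreGaloisCohomology1997, I §5.1 (principal crossed homomorphisms)] -/
theorem exists_contOneCocycles_apply_eq_sub (v : X) (hv : Continuous fun g : G => X.ρ g v) :
    ∃ b : contOneCocycles X, ∀ g, b.1 g = X.ρ g v - v := by
  refine ⟨⟨⟨fun g => X.ρ g v - v, hv.sub continuous_const⟩, fun g h => ?_⟩, fun g => rfl⟩
  change X.ρ (g * h) v - v = (X.ρ g v - v) + X.ρ g (X.ρ h v - v)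
  rw [map_mul]
  change X.ρ g (X.ρ h v) - v = _
  rw [map_sub]
  abel

/-- A coboundary has trivial class. [cite: SerreGaloisCohomology1997, I §5.1] -/
theorem oneCocycleClass_eq_zero_of_forall_apply_eq_sub (b : contOneCocycles X) (v : X)
    (hb : ∀ g, b.1 g = X.ρ g v - v) : oneCocycleClass X b = 0 :=
  (oneCocycleClass_eq_zero_iff X b).2 ⟨v, hb⟩

/-- The cocycle `0` is the only cocycle vanishing identically; class form: a cocycle vanishing as a
function has trivial class. [cite: SerreGaloisCohomology1997, I §5.1] -/
theorem oneCocycleClass_eq_zero_of_forall_apply_eq_zero (z : contOneCocycles X)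
    (hz : ∀ g, z.1 g = 0) : oneCocycleClass X z = 0 :=
  (oneCocycleClass_eq_zero_iff X z).2 ⟨0, fun g => by rw [hz, map_zero, sub_zero]⟩

omit [IsTopologicalGroup G] in
/-- Scalar multiples of cocycles are computed pointwise. [cite: SerreGaloisCohomology1997, I §2.2] -/
theorem contOneCocycles.smul_apply (r : R) (z : contOneCocycles X) (g : G) :
    (r • z).1 g = r • z.1 g := by
  rw [Submodule.coe_smul, ContinuousMap.smul_apply]

omit [IsTopologicalGroup G] in
/-- Differences of cocycles are computed pointwise. [cite: SerreGaloisCohomology1997, I §2.2] -/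
theorem contOneCocycles.sub_apply (z z' : contOneCocycles X) (g : G) :
    (z - z').1 g = z.1 g - z'.1 g := by
  rw [Submodule.coe_sub, ContinuousMap.sub_apply]

/-- **The lift of an `r`-torsion class to an `r`-torsion cocycle.** Let `X` be a topological
representation of `G` with continuous orbit maps, and `r ∈ R` a scalar acting SURJECTIVELY on `X`.
If `r·c = 0` in `H¹(G, X)` then `c` is represented by a continuous cocycle `z` with `r·z(g) = 0`
for all `g`: writing `c = [z₀]`, `r·z₀ = ∂m` is a coboundary, `m = r·m'`, and `z := z₀ − ∂m'`
works (`r·∂m' = ∂(r·m') = ∂m` because each `g` acts `R`-linearly). (Used with `r = T` on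
`T ⊗ Λ^*`, on which `T = γ − 1` is onto, in Greenberg's proof that `X^Σ` is finitely generated.)
[cite: SerreGaloisCohomology1997, I §2.2 and I §5.1 (H¹ via crossed homomorphisms modulo principal ones)]
[cite: GreenbergLNM1716, §4, proof of Props. 4.9–4.10 (the sequence 0 → 𝒜[θ] → 𝒜 →θ 𝒜 → 0)] -/
theorem exists_oneCocycleClass_eq_forall_smul_apply_eq_zero
    (hX : ∀ v : X, Continuous fun g : G => X.ρ g v) (r : R)
    (hr : Function.Surjective fun m : X => r • m)
    (c : continuousCohomology 1 X) (hc : r • c = 0) :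
    ∃ z : contOneCocycles X, oneCocycleClass X z = c ∧ ∀ g, r • z.1 g = 0 := by
  obtain ⟨z₀, rfl⟩ := oneCocycleClass_surjective X c
  rw [← oneCocycleClass_smul, oneCocycleClass_eq_zero_iff] at hc
  obtain ⟨m, hm⟩ := hc
  obtain ⟨m', hm'⟩ := hr m
  obtain ⟨b, hb⟩ := exists_contOneCocycles_apply_eq_sub X m' (hX m')
  refine ⟨z₀ - b, ?_, fun g => ?_⟩
  · rw [oneCocycleClass_sub, oneCocycleClass_eq_zero_of_forall_apply_eq_sub X b m' hb, sub_zero]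
  · have h := hm g
    rw [contOneCocycles.smul_apply] at h
    rw [contOneCocycles.sub_apply, smul_sub, h, hb, smul_sub, ← map_smul, ← hm']
    exact sub_self _

end Lift

/-! ### §2. Cocycles of a compact group with values in a discrete module are torsion -/

section Compact

open TopRep ContRepresentation ContinuousCohomology

variable {R : Type u} [Ring R] [TopologicalSpace R]
variable {G : Type v} [Group G] [TopologicalSpace G] [IsTopologicalGroup G] [CompactSpace G]
variable (X : TopRep.{v} R G) [DiscreteTopology X]

omit [IsTopologicalGroup G] in
/-- A continuous cocycle of a compact group with values in a discrete module takes finitely many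
values. [cite: SerreGaloisCohomology1997, I §2.2 (continuous cochains with values in a discrete module are locally constant)] -/
theorem contOneCocycles.finite_range (z : contOneCocycles X) : (Set.range z.1).Finite :=
  (isCompact_range z.1.continuous).finite_of_discrete

omit [IsTopologicalGroup G] in
/-- **Cocycles are `r`-power torsion when the module is**: if every element of the discrete module
`X` is killed by a power of `r ∈ R`, then so is every continuous cocycle of the compact group `G`
(finitely many values). [cite: SerreGaloisCohomology1997, I §2.2 (cochains with values in a discrete torsion module)] -/
theorem contOneCocycles.exists_pow_smul_apply_eq_zero (r : R) (hr : ∀ m : X, ∃ n : ℕ, r ^ n • m = 0)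
    (z : contOneCocycles X) : ∃ n : ℕ, ∀ g, r ^ n • z.1 g = 0 := by
  classical
  have hfin := contOneCocycles.finite_range X z
  choose n hn using hr
  refine ⟨hfin.toFinset.sup n, fun g => ?_⟩
  have hle : n (z.1 g) ≤ hfin.toFinset.sup n :=
    Finset.le_sup (hfin.mem_toFinset.mpr ⟨g, rfl⟩)
  obtain ⟨k, hk⟩ := Nat.exists_eq_add_of_le hle
  rw [hk, add_comm, pow_add, mul_smul, hn, smul_zero]

omit [IsTopologicalGroup G] [CompactSpace G] [DiscreteTopology X] in
/-- Enlarging the exponent: `r^n · z = 0` pointwise implies `r^N · z = 0` for `N ≥ n`.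
[cite: SerreGaloisCohomology1997, I §2.2] -/
theorem contOneCocycles.pow_smul_apply_eq_zero_of_le (r : R) (z : contOneCocycles X) {n N : ℕ}
    (hn : ∀ g, r ^ n • z.1 g = 0) (hN : n ≤ N) (g : G) : r ^ N • z.1 g = 0 := by
  obtain ⟨k, hk⟩ := Nat.exists_eq_add_of_le hN
  rw [hk, add_comm, pow_add, mul_smul, hn, smul_zero]

omit [IsTopologicalGroup G] [CompactSpace G] [DiscreteTopology X] in
/-- A cocycle killed pointwise by `s` is killed by `s` in the module of cocycles.
[cite: SerreGaloisCohomology1997, I §2.2] -/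
theorem contOneCocycles.smul_eq_zero_of_forall (s : R) (z : contOneCocycles X)
    (hz : ∀ g, s • z.1 g = 0) : s • z = 0 :=
  Subtype.ext (ContinuousMap.ext fun g => by rw [contOneCocycles.smul_apply, hz]; rfl)

omit [CompactSpace G] [DiscreteTopology X] in
/-- A cocycle killed pointwise by `s` has class killed by `s`. [cite: SerreGaloisCohomology1997, I §2.2] -/
theorem oneCocycleClass_smul_eq_zero_of_forall (s : R) (z : contOneCocycles X)
    (hz : ∀ g, s • z.1 g = 0) : s • oneCocycleClass X z = 0 := by
  rw [← oneCocycleClass_smul, contOneCocycles.smul_eq_zero_of_forall X s z hz, oneCocycleClass_zero]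

/-- **Every class of `H¹(G, X)` is killed by a power of `r`** (`G` compact, `X` discrete and
`r`-power torsion). [cite: SerreGaloisCohomology1997, I §2.2 (H^q(G, A) is torsion for a discrete torsion module)] -/
theorem exists_pow_smul_eq_zero (r : R) (hr : ∀ m : X, ∃ n : ℕ, r ^ n • m = 0)
    (c : continuousCohomology 1 X) : ∃ n : ℕ, r ^ n • c = 0 := by
  obtain ⟨z, rfl⟩ := oneCocycleClass_surjective X c
  obtain ⟨n, hn⟩ := contOneCocycles.exists_pow_smul_apply_eq_zero X r hr z
  exact ⟨n, oneCocycleClass_smul_eq_zero_of_forall X (r ^ n) z hn⟩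

/-- Two scalars at once: if `X` is `r`-power torsion and `s`-power torsion, every class of
`H¹(G, X)` is killed by `r^n` and `s^n` for one `n` (used with `r = T`, `s = p` on
`H¹(Γ_K, T ⊗ Λ^*)`: the Pontryagin dual is `(p, T)`-separated).
[cite: SerreGaloisCohomology1997, I §2.2 (H^q(G, A) is torsion for a discrete torsion module)] -/
theorem exists_pow_smul_eq_zero_and (r s : R) (hr : ∀ m : X, ∃ n : ℕ, r ^ n • m = 0)
    (hs : ∀ m : X, ∃ n : ℕ, s ^ n • m = 0) (c : continuousCohomology 1 X) :
    ∃ n : ℕ, r ^ n • c = 0 ∧ s ^ n • c = 0 := by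
  obtain ⟨z, rfl⟩ := oneCocycleClass_surjective X c
  obtain ⟨a, ha⟩ := contOneCocycles.exists_pow_smul_apply_eq_zero X r hr z
  obtain ⟨b, hb⟩ := contOneCocycles.exists_pow_smul_apply_eq_zero X s hs z
  exact ⟨max a b,
    oneCocycleClass_smul_eq_zero_of_forall X _ z
      (contOneCocycles.pow_smul_apply_eq_zero_of_le X r z ha (le_max_left a b)),
    oneCocycleClass_smul_eq_zero_of_forall X _ z
      (contOneCocycles.pow_smul_apply_eq_zero_of_le X s z hb (le_max_right a b))⟩

end Compact

/-! ### §3. Restriction along `θ : H → Γ` on cocycles (`ContinuousRep` / `resH1` convention) -/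

section Res

variable {A : Type*} [CommRing A] [TopologicalSpace A]
variable {Γ : Type u} [Group Γ] [TopologicalSpace Γ] [IsTopologicalGroup Γ]
variable {H : Type u} [Group H] [TopologicalSpace H] [IsTopologicalGroup H]
variable {M : Type u} [AddCommGroup M] [Module A M] [TopologicalSpace M] [DiscreteTopology M]
  [ContinuousSMul A M]

/-- **Restriction on cocycles**: `res_θ [z] = 0` in `H¹(H, M)` iff `z ∘ θ` is principal,
`∃ a, ∀ h, z(θ h) = θ(h)·a − a`. [cite: SerreGaloisCohomology1997, I §2.4 and I §5.1] -/
theorem resH1_oneCocycleClass_eq_zero_iff (ρ : ContinuousRep Γ A M) (θ : H →ₜ* Γ)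
    (z : contOneCocycles ρ.toTopRep) :
    resH1 ρ θ (oneCocycleClass ρ.toTopRep z) = 0 ↔ ∃ a : M, ∀ h, z.1 (θ h) = ρ (θ h) a - a := by
  rw [resH1, map_oneCocycleClass, oneCocycleClass_eq_zero_iff]
  rfl

/-- If `res_θ [z] = 0` and `θ(H)` acts TRIVIALLY on `M`, then `z` VANISHES on `θ(H)` (a coboundary
for a trivial action is zero). (At an unramified place: a Selmer cocycle vanishes on the inertia
group when inertia acts trivially on the coefficients.) [cite: SerreGaloisCohomology1997, I §2.4 and I §5.1] -/
theorem apply_eq_zero_of_resH1_eq_zero (ρ : ContinuousRep Γ A M) (θ : H →ₜ* Γ)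
    (hθ : ∀ (h : H) (m : M), ρ (θ h) m = m) (z : contOneCocycles ρ.toTopRep)
    (hz : resH1 ρ θ (oneCocycleClass ρ.toTopRep z) = 0) (h : H) : z.1 (θ h) = 0 := by
  obtain ⟨a, ha⟩ := (resH1_oneCocycleClass_eq_zero_iff ρ θ z).1 hz
  rw [ha, hθ, sub_self]

/-- Conversely, a cocycle vanishing on `θ(H)` as a function restricts to the zero class.
[cite: SerreGaloisCohomology1997, I §2.4 and I §5.1] -/
theorem resH1_oneCocycleClass_eq_zero_of_forall_apply_eq_zero (ρ : ContinuousRep Γ A M)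
    (θ : H →ₜ* Γ) (z : contOneCocycles ρ.toTopRep) (hz : ∀ h, z.1 (θ h) = 0) :
    resH1 ρ θ (oneCocycleClass ρ.toTopRep z) = 0 :=
  (resH1_oneCocycleClass_eq_zero_iff ρ θ z).2 ⟨0, fun h => by rw [hz, map_zero, sub_zero]⟩

omit [IsTopologicalGroup Γ] in
/-- The orbit maps of a `ContinuousRep` are continuous (input `hX` of the lift
`exists_oneCocycleClass_eq_forall_smul_apply_eq_zero` for `X = ρ.toTopRep`). [cite: SerreGaloisCohomology1997, I §2.2] -/
theorem continuous_toTopRep_ρ_apply (ρ : ContinuousRep Γ A M) (v : M) :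
    Continuous fun g : Γ => ρ.toTopRep.ρ g v :=
  ρ.continuous_apply_left v

omit [IsTopologicalGroup Γ] in
/-- The action of `ρ.toTopRep` is `ρ`. [cite: SerreGaloisCohomology1997, I §2.2] -/
theorem toTopRep_ρ_apply (ρ : ContinuousRep Γ A M) (g : Γ) (m : M) : ρ.toTopRep.ρ g m = ρ g m :=
  rfl

omit [IsTopologicalGroup Γ] in
/-- **Conjugation of vanishing loci**: if a cocycle `z : Γ → M` vanishes at `σ`, then at the
conjugate `g σ g⁻¹` it takes the coboundary value `τ·a − a`, `τ = gσg⁻¹`, `a = −z(g)`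
(`z(gσg⁻¹) = z(g) + (gσ)·z(g⁻¹)` and `g⁻¹·z(g) = −z(g⁻¹)`). [cite: SerreGaloisCohomology1997, I §5.1 (crossed homomorphisms)] -/
theorem contOneCocycles.apply_conj_eq_of_apply_eq_zero (ρ : ContinuousRep Γ A M)
    (z : contOneCocycles ρ.toTopRep) (g σ : Γ) (hσ : z.1 σ = 0) :
    z.1 (g * σ * g⁻¹) = ρ (g * σ * g⁻¹) (-z.1 g) - -z.1 g := by
  have h1 : z.1 (g⁻¹ * g) = z.1 g⁻¹ + ρ g⁻¹ (z.1 g) := z.2 g⁻¹ g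
  rw [inv_mul_cancel, contOneCocycles.apply_one] at h1
  have hinv : ρ g⁻¹ (z.1 g) = -z.1 g⁻¹ := eq_neg_of_add_eq_zero_right h1.symm
  have h2 : z.1 (g * σ * g⁻¹) = z.1 (g * σ) + ρ (g * σ) (z.1 g⁻¹) := z.2 (g * σ) g⁻¹
  have h3 : z.1 (g * σ) = z.1 g + ρ g (z.1 σ) := z.2 g σ
  have h4 : ρ (g * σ * g⁻¹) (z.1 g) = -(ρ (g * σ) (z.1 g⁻¹)) := by
    rw [map_mul, Module.End.mul_apply, hinv, map_neg]
  rw [h2, h3, hσ, map_zero, add_zero, map_neg, h4, neg_neg, sub_neg_eq_add, add_comm]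

end Res

/-! ### §4. Finiteness of the cocycles unramified outside `S` with finite coefficients -/

section Finite

variable {K : Type u} [Field K] [NumberField K]
variable {A : Type*} [CommRing A] [TopologicalSpace A]
variable {M : Type u} [AddCommGroup M] [Module A M] [TopologicalSpace M] [DiscreteTopology M]
  [ContinuousSMul A M]

omit [NumberField K] in
/-- Only finitely many finite places of `K` lie above a non-zero natural number (`Ideal.finite_factors`);
used for `S_p = {w ∣ p}`. [cite: NeukirchANT1999, Ch. I §3 (unique factorisation of ideals), §8] -/
theorem finite_setOf_natCast_mem_asIdeal [NumberField K] {n : ℕ} (hn : n ≠ 0) :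
    {w : HeightOneSpectrum (𝓞 K) | ((n : ℕ) : 𝓞 K) ∈ w.asIdeal}.Finite := by
  have hI : (Ideal.span {((n : ℕ) : 𝓞 K)} : Ideal (𝓞 K)) ≠ ⊥ := by
    rw [Ne, Ideal.span_singleton_eq_bot]
    exact_mod_cast hn
  exact (Ideal.finite_factors hI).subset fun w hw => Ideal.dvd_span_singleton.mpr hw

/-- **Silverman X.4.3 on cocycles, `localMap` convention.** Let `ρ` be a continuous representation
of `Γ_K` on a discrete `A`-module `M`, `r ∈ A` a scalar whose torsion `M[r] = {m | r·m = 0}` is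
FINITE, and `S` a finite set of finite places of `K`. Then the continuous cocycles `z : Γ_K → M`
killed pointwise by `r` and VANISHING on the inertia group `localMap K (Sum.inr w) (I_{K_w})` of every
finite place `w ∉ S` form a finite set. Proof: such a `z` is a continuous cocycle of the finite
discrete `Γ_K`-module `M[r]` (continuous action: `torsionRep ρ r`), and its class is unramified
outside `S` in the sense of `h1Unramified` — at the prime `𝔓₀` of `\bar ℤ_K` cut out by `K̄ → K̄_w`
because `I_{𝔓₀}` is the image of `I_{K_w}` (`inertia_adicCompletionPrime_eq_map_absInertia`), and at
any other prime `𝔓 = g·𝔓₀` above `w` (`exists_smul_eq_of_mem_primesAbove_holds`,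
`I_{g·𝔓₀} = g I_{𝔓₀} g⁻¹`) because there `z` is the coboundary of `−z(g)`
(`contOneCocycles.apply_conj_eq_of_apply_eq_zero`) —, so these cocycles inject into the finite set
`finite_setOf_oneCocycleClass_mem_h1Unramified` (Lemma X.4.3, PROVED in the tree from Prop. VIII.1.6
`finite_unramifiedHoms_holds`). [cite: SilvermanAEC2009, Lemma X.4.3 (with its proof)]
[cite: NeukirchANT1999, Ch. I §9 (9.4) (conjugate primes and inertia groups)] -/
theorem finite_setOf_contOneCocycles_smul_eq_zero_vanishing_inertia
    (ρ : ContinuousRep (absoluteGaloisGroup K) A M) (r : A) (hfin : {m : M | r • m = 0}.Finite)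
    {S : Set (HeightOneSpectrum (𝓞 K))} (hS : S.Finite) :
    {z : contOneCocycles ρ.toTopRep | (∀ g, r • z.1 g = 0) ∧
      ∀ w : HeightOneSpectrum (𝓞 K), w ∉ S →
        ∀ σ : LocalGroup K (Sum.inr w), z.1 (localMap K (Sum.inr w) σ) = 0}.Finite := by
  classical
  -- the finite discrete `Γ_K`-module `N = M[r]`
  haveI hN : Finite (Submodule.torsionBy A M r) :=
    Set.finite_coe_iff.mpr (hfin.subset fun m hm => (Submodule.mem_torsionBy_iff r m).1 hm)
  letI : DistribMulAction (absoluteGaloisGroup K) (Submodule.torsionBy A M r) :=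
    DistribMulAction.compHom _ (torsionRep ρ r).toRepresentation
  have hsmul : ∀ (g : absoluteGaloisGroup K) (n : Submodule.torsionBy A M r),
      ((g • n : Submodule.torsionBy A M r) : M) = ρ g n := fun _ _ => rfl
  haveI : ContinuousSMul (absoluteGaloisGroup K) (Submodule.torsionBy A M r) :=
    ⟨(torsionRep ρ r).continuous_smul⟩
  -- the finite target: cocycles of `N` with class unramified outside `S`
  have hT := finite_setOf_oneCocycleClass_mem_h1Unramified (M := Submodule.torsionBy A M r)
    (finite_unramifiedHoms_holds K) hS
  haveI := hT.to_subtype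
  -- the comparison map
  refine Set.finite_coe_iff.mp (Finite.of_injective (β := {c : contOneCocycles
      (discreteTopRep (absoluteGaloisGroup K) (Submodule.torsionBy A M r)) |
      oneCocycleClass _ c ∈ h1Unramified (Submodule.torsionBy A M r) S})
    (fun z => ⟨⟨⟨fun g => ⟨z.1.1 g, (Submodule.mem_torsionBy_iff r _).2 (z.2.1 g)⟩,
      z.1.1.continuous.subtype_mk _⟩, fun g h => Subtype.ext (by
        change z.1.1 (g * h) = z.1.1 g + ρ g (z.1.1 h)
        exact z.1.2 g h)⟩, ?_⟩) fun z z' hzz' => ?_)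
  · -- the class is unramified outside `S`
    refine mem_h1Unramified_iff.2 fun v hv 𝔓 h𝔓 => ?_
    refine (oneCocycleClass_mem_subgroupResKer_iff _ _).2 ?_
    obtain ⟨g, hg⟩ := HeightOneSpectrum.exists_smul_eq_of_mem_primesAbove_holds
      (adicCompletionPrime_mem_primesAbove K v) h𝔓
    refine ⟨⟨-z.1.1 g, (Submodule.mem_torsionBy_iff r _).2 (by rw [smul_neg, z.2.1 g, neg_zero])⟩,
      fun σ => Subtype.ext ?_⟩
    -- `σ = g σ₀ g⁻¹` with `σ₀ ∈ I_{𝔓₀} = res(I_{K_v})`, where `z` vanishes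
    have hσ₀ : g⁻¹ * (σ : absoluteGaloisGroup K) * g ∈
        (adicCompletionPrime K v).inertia (absoluteGaloisGroup K) := by
      rw [← HeightOneSpectrum.mem_inertia_smul_absIntegers_iff, hg]; exact σ.2
    rw [inertia_adicCompletionPrime_eq_map_absInertia] at hσ₀
    obtain ⟨τ, hτ, hτσ⟩ := Subgroup.mem_map.mp hσ₀
    have hz0 : z.1.1 (g⁻¹ * (σ : absoluteGaloisGroup K) * g) = 0 := by
      rw [← hτσ]
      exact z.2.2 v hv ⟨τ, hτ⟩
    have hconj := contOneCocycles.apply_conj_eq_of_apply_eq_zero ρ z.1 g _ hz0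
    rw [show g * (g⁻¹ * (σ : absoluteGaloisGroup K) * g) * g⁻¹ = σ by group] at hconj
    change z.1.1 σ = ((((σ : absoluteGaloisGroup K) • _ : Submodule.torsionBy A M r)) : M) - _
    rw [hsmul]
    exact hconj
  · -- injectivity: a cocycle is determined by its values
    have h := congrArg (fun c : {c : contOneCocycles
      (discreteTopRep (absoluteGaloisGroup K) (Submodule.torsionBy A M r)) |
      oneCocycleClass _ c ∈ h1Unramified (Submodule.torsionBy A M r) S} => fun g => (c.1.1 g : M)) hzz'
    exact Subtype.ext (Subtype.ext (ContinuousMap.ext fun g => congrFun h g))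

end Finite


end Literature.NumberTheory.EllipticCurves.BigGaloisRep

end
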